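import Literature.NumberTheory.EllipticCurves.Kato2004.ZetaElementNewformTatePairingValuesTwo
import Literature.NumberTheory.EllipticCurves.KatoFineSelmerDual
import Literature.NumberTheory.Automorphic.Sweep1
import Literature.NumberTheory.EllipticCurves.Newforms
import Summits.BirchSwinnertonDyer.BirchSwinnertonDyer.Theorems.ResidualThetaTransportAtTwoDefs
import Mathlib.Algebra.Module.CharacterModule
import Mathlib.RingTheory.Localization.FractionRing
import HarnessLib

/-!
# Sketch (stub-ideation k2 g31, crux `ResidualThetaCountLowerPureAtTwo`, stub `stub_cmLambdaLower`) — «Kato125AB»: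
# the MERGED successor of the print node `stub_kzgChildB` (critic S165 / Q165) typed ON TOP OF the landed fact
# `Kato2004.exists_zetaElement_newform_tatePairing_values_two` (p726418): its binder telescope VERBATIM, plus
# (F1) the CM hypothesis, (F5) the `𝒪`-structure / dual-fine-Selmer pins, and the appended clauses (FIN), (FINX), (LAM);
# then the definitional bridges to the consumer's `zetaQuot` / `lamO` and the vanishing of child B's `μt := 1` slack.

Nothing here is proposed to the tree; `KatoValuesQuotientTwoText` is a `def … : Prop` (a TEXT, nothing asserted);
the three small theorems are sorry-free. BSD is not proved by anything here; items 22608 / 26074 stay OPEN, 24105 HOLD.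
-/

set_option autoImplicit false
set_option linter.dupNamespace false

noncomputable section

open scoped Classical NumberField TensorProduct
open Field IsDedekindDomain CongruenceSubgroup NumberField WeierstrassCurve
open Literature.NumberTheory.GaloisRepresentations
open Literature.NumberTheory.Automorphic
open Literature.NumberTheory.EllipticCurves Literature.NumberTheory.EllipticCurves.ModularForms
open Literature.NumberTheory.EllipticCurves.Kobayashi2003 Literature.NumberTheory.EllipticCurves.GreenbergSelmer
open Literature.NumberTheory.EllipticCurves.Kato2004
open Literature.NumberTheory.EllipticCurves.Kato2004.EulerSystemValues
open ZpExtension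

namespace Summit.BirchSwinnertonDyer.BirchSwinnertonDyer.Cruxes.ResidualThetaCountLowerPureAtTwo.SideaK2G31

/-- **«Kato125AB» TEXT (proposal, not a tree fact).** `Kato2004.exists_zetaElement_newform_tatePairing_values_two`
(p726418) with (F1) `IsCMForm (liftToGamma1 M 2 g)` added, (F5) the `𝒪`-instance binders of `I.H` and the dual fine
Selmer pin `X` added, and the conclusion extended by (FIN) ∧ (FINX) ∧ (LAM) for THE SAME existential witness `z`
(critic S165: "A's fact with B's clauses appended"; T92: no `∀`-over-valued-classes).
[cite: Kato2004Asterisque, Thm. 12.5 (1)–(2) (pp. 221–222), §15.16 (p. 265)] [cite: BurungaleTian2026, Thm. 2.6, Rem. 2.7 (p. 5)] -/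
def KatoValuesQuotientTwoText : Prop :=
  ∀ (M : ℕ) [NeZero M] (g : CuspForm (Gamma0 M) 2) (ι : coeffField g →+* PadicAlgCl 2) (Ω : ℂ)
    (ρ : FramedGaloisRep ℚ (padicCoeffIntegers (Set.range ι)) 2)
    (κ : ZpExtension ℚ 2) (γ : absoluteGaloisGroup ℚ),
    IsNewform0 g → IsPlusPeriod g Ω →
    -- [k2-g31 (F1)] BT26 Thm 2.6 is CM-only: the appended (LAM) clause needs the CM hypothesis (the consumer has `hcmg`)
    IsCMForm (liftToGamma1 M 2 g) →
    (∀ v : HeightOneSpectrum (𝓞 ℚ), ¬ Rat.HeightOneSpectrum.natGenerator v ∣ 2 * M →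
      ρ.IsUnramifiedAt v ∧
        ∃ P : Polynomial (padicCoeffIntegers (Set.range ι)),
          P.map (padicCoeffIntegers (Set.range ι)).subtype =
              Polynomial.X ^ 2
                - Polynomial.C (embCoeff g ι (Rat.HeightOneSpectrum.natGenerator v)) * Polynomial.X
                + Polynomial.C ((Rat.HeightOneSpectrum.natGenerator v : ℕ) : PadicAlgCl 2) ∧
            ρ.HasFrobCharpolyAt v P) →
    κ.IsCyclotomic → κ.IsTopGenerator γ →
  ∀ (I : IwasawaH1DataCoeff ρ.toGaloisRep 2 κ γ)
    -- [k2-g31 (F5)] the `𝒪`-structure of `𝐇¹_Γ(T_ρ)` (the consumer's instance binders, verbatim) …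
    [Module ↥(padicCoeffIntegers (Set.range ι)) I.H]
    [IsScalarTower ↥(padicCoeffIntegers (Set.range ι)) (IwasawaAlgebraO (Set.range ι)) I.H]
    -- … and the dual fine Selmer group `X₀(A_ρ/ℚ_∞)` PINNED BY MEMBERSHIP (pin-free: `GreenbergSelmer.fineSelmerInfty`), with its
    -- `𝒪`-structure pinned to `scalarH1` (the consumer's `Sg`/`hSgO` idiom; `CharacterModule` then carries the `𝒪`-action)
    (X : AddSubgroup (subgroupH1 κ.kerSubgroup (Cofree ρ ↥(padicCoeffField (Set.range ι)))))
    [Module ↥(padicCoeffIntegers (Set.range ι)) ↥X],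
    (∀ (a : ↥(padicCoeffIntegers (Set.range ι))) (s : ↥X),
      ((a • s : ↥X) : subgroupH1 κ.kerSubgroup (Cofree ρ ↥(padicCoeffField (Set.range ι)))) =
        scalarH1 κ.kerSubgroup (Cofree ρ ↥(padicCoeffField (Set.range ι))) a
          (s : subgroupH1 κ.kerSubgroup (Cofree ρ ↥(padicCoeffField (Set.range ι))))) →
    (∀ y : subgroupH1 κ.kerSubgroup (Cofree ρ ↥(padicCoeffField (Set.range ι))),
      y ∈ X ↔ y ∈ GreenbergSelmer.fineSelmerInfty (Cofree ρ ↥(padicCoeffField (Set.range ι))) κ) →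
  ∀
    -- the auxiliary elliptic curve, the place above `2`, and the local transport `Θ : A_ρ ≃ E[2^∞]ⁿ` at `v`
    (W : WeierstrassCurve ℚ) [W.IsElliptic] [W.IsGloballyMinimal] (n : ℕ)
    (v : HeightOneSpectrum (𝓞 ℚ)) (hv : ((2 : ℕ) : 𝓞 ℚ) ∈ v.asIdeal)
    (Θ : Cofree ρ ↥(padicCoeffField (Set.range ι)) ≃+ (Fin n → ↥(W.geomPrimaryTorsion 2)))
    (hΘ : ∀ (δ : absoluteGaloisGroup (v.adicCompletion ℚ)) (m : Cofree ρ ↥(padicCoeffField (Set.range ι))) (i : Fin n),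
      Θ (resGalOfEmb (closureEmb (K := ℚ) (v.adicCompletion ℚ)) δ • m) i =
        resGalOfEmb (closureEmb (K := ℚ) (v.adicCompletion ℚ)) δ • Θ m i)
    -- Frobenius datum `t₀` of `𝒪/ℤ₂` with dual families (the pins `t₀`, `bO`, `bO'`; they make `t₀` non-degenerate)
    (t₀ : ↥(padicCoeffIntegers (Set.range ι)) →+ ℤ_[2])
    (ht₀ : ∀ (c : ℤ_[2]) (a : ↥(padicCoeffIntegers (Set.range ι))), t₀ (padicIntToCoeffIntegers (Set.range ι) c * a) = c * t₀ a)
    (nb : ℕ) (bO bO' : Fin nb → ↥(padicCoeffIntegers (Set.range ι)))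
    (hbO : ∀ a : ↥(padicCoeffIntegers (Set.range ι)), a = ∑ i, padicIntToCoeffIntegers (Set.range ι) (t₀ (a * bO' i)) * bO i)
    -- the self-dual tower `e_k : A_ρ[2^k] × A_ρ[2^k] → μ_{2^k}` pinned by `t₀` and a choice `ζ` of roots of unity
    (ζ : ℕ → AlgebraicClosure ℚ) (hζ : ∀ k, IsPrimitiveRoot (ζ k) (2 ^ k))
    (ePk : ∀ k : ℕ, ↥(AddSubgroup.torsionBy (Cofree ρ ↥(padicCoeffField (Set.range ι))) ((2 ^ k : ℕ) : ℤ)) →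
      ↥(AddSubgroup.torsionBy (Cofree ρ ↥(padicCoeffField (Set.range ι))) ((2 ^ k : ℕ) : ℤ)) → AlgebraicClosure ℚ)
    (hμPk : ∀ k a b, ePk k a b ^ (2 ^ k) = 1)
    (hadd₁Pk : ∀ k a₁ a₂ b, ePk k (a₁ + a₂) b = ePk k a₁ b * ePk k a₂ b)
    (hadd₂Pk : ∀ k a b₁ b₂, ePk k a (b₁ + b₂) = ePk k a b₁ * ePk k a b₂)
    (hgalPk : ∀ k (σ : absoluteGaloisGroup ℚ)
      (a b : ↥(AddSubgroup.torsionBy (Cofree ρ ↥(padicCoeffField (Set.range ι))) ((2 ^ k : ℕ) : ℤ))),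
      σ • ePk k a b = ePk k (cofreeTorsionGaloisModule (Set.range ι) ρ _ σ a) (cofreeTorsionGaloisModule (Set.range ι) ρ _ σ b))
    (hePk : ∀ k (s t : Fin 2 → ↥(padicCoeffIntegers (Set.range ι))),
      ePk k (divPowCofreeMkTorsion (Set.range ι) ρ k s) (divPowCofreeMkTorsion (Set.range ι) ρ k t) =
        ζ k ^ (PadicInt.toZModPow k (t₀ (s 0 * t 1 - s 1 * t 0))).val)
    -- THE `ℤ₂`-valued layer Tate pairing family, pinned by its residues (hypothesis by name)
    (pair : ∀ m : ℕ, H1 (FramedGaloisRep.toGaloisRep ρ) (κ.layerSubgroup m) →+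
      ((Fin n → ↥(localLayerPointsOfEmb κ (closureEmb (K := ℚ) (v.adicCompletion ℚ)) W m)) →+ ℤ_[2])),
    (∀ (m k : ℕ) (x : H1 (FramedGaloisRep.toGaloisRep ρ) (κ.layerSubgroup m))
      (Q : Fin n → ↥(localLayerPointsOfEmb κ (closureEmb (K := ℚ) (v.adicCompletion ℚ)) W m)),
      PadicInt.toZModPow k (pair m x Q) =
        CyclotomicLayer.rhoLayerPairingPk (Set.range ι) ρ W ePk hμPk hadd₁Pk hadd₂Pk hgalPk Θ κ v hΘ m k x Q) →
  -- the `2`-adic frame: `Φ : ℚ̄₂ ≅ ℚ̄_v` over `φ : ℚ₂ ≅ ℚ_v`, primitive roots `ζc_k`, a tower `e_k : ℚ(ζ_{2^k}) → ℚ̄₂` COHERENT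
  -- along `ζc_k ↦ ζc_{k+1}²`, and Galois lifts `τ_k(a)` acting on `e_k(ζc_k)` by `a`-th powers
  ∀ (Φ : AlgebraicClosure ℚ_[2] ≃ₐ[ℚ] AlgebraicClosure (v.adicCompletion ℚ)) (φ : ℚ_[2] ≃+* v.adicCompletion ℚ),
    (∀ y : ℚ_[2], Φ (algebraMap ℚ_[2] (AlgebraicClosure ℚ_[2]) y) =
      algebraMap (v.adicCompletion ℚ) (AlgebraicClosure (v.adicCompletion ℚ)) (φ y)) →
  ∀ (ζc : ∀ k : ℕ, CyclotomicField (2 ^ k) ℚ) (hζc : ∀ k : ℕ, IsPrimitiveRoot (ζc k) (2 ^ k))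
    (e : ∀ k : ℕ, CyclotomicField (2 ^ k) ℚ →ₐ[ℚ] PadicAlgCl 2)
    (τ : ∀ k : ℕ, ZMod (2 ^ k) → Field.absoluteGaloisGroup ℚ_[2]),
    (∀ k : ℕ, e (k + 1) (ζc (k + 1)) ^ 2 = e k (ζc k)) →
    (∀ (k : ℕ) (a : ZMod (2 ^ k)), IsUnit a → τ k a • e k (ζc k) = e k (ζc k) ^ a.val) →
  -- CONCLUSION: Kato's class, the comparison functionals, the RATIONAL values, the period ratio
  ∃ (z : I.H) (ℓ : Fin n → (PadicAlgCl 2 →ₗ[ℚ_[2]] ℚ_[2])) (L : ℕ → ℕ)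
    (f : ∀ N : ℕ, Fin (L N) → coeffField g) (u : ∀ N : ℕ, Fin (L N) → CyclotomicField (2 ^ N) ℚ)
    (r : coeffField g),
    r ≠ 0 ∧
    -- (ND) the comparison functionals separate `𝒪`
    Function.Injective (fun (a : ↥(padicCoeffIntegers (Set.range ι))) (i : Fin n) => ℓ i (a : PadicAlgCl 2)) ∧
    -- (BK) the layer pairing of `proj_m (a • z)` against a formal point in coordinate `i` = trace of `log_W(Q₀) · (value)`
    (∀ (a : ↥(padicCoeffIntegers (Set.range ι))) (m : ℕ) (i : Fin n) (Q₀ : localPoints W ℚ_[2])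
      (hQv : WeierstrassCurve.Affine.Point.map (W' := W)
          (Φ : AlgebraicClosure ℚ_[2] →ₐ[ℚ] AlgebraicClosure (v.adicCompletion ℚ))
          (show (W.baseChange (AlgebraicClosure ℚ_[2])).toAffine.Point from Q₀) ∈
        localLayerPointsOfEmb κ (closureEmb (K := ℚ) (v.adicCompletion ℚ)) W m),
      (∀ (X Y : AlgebraicClosure ℚ_[2]) (hXY : (W.baseChange (AlgebraicClosure ℚ_[2])).toAffine.Nonsingular X Y),
          (show (W.baseChange (AlgebraicClosure ℚ_[2])).toAffine.Point from Q₀) = .some X Y hXY → 1 < Valued.v X) →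
      algebraMap ℚ_[2] (PadicAlgCl 2)
          ((pair m (I.proj m ((PowerSeries.C (a : ↥(padicCoeffIntegers (Set.range ι))) :
              IwasawaAlgebraO (Set.range ι)) • z)) (Pi.single i ⟨_, hQv⟩) : ℤ_[2]) : ℚ_[2]) =
        ∑ k : Fin (L (m + 2)), algebraMap ℚ_[2] (PadicAlgCl 2) (ℓ i ((a : PadicAlgCl 2) * ι (f (m + 2) k))) *
          ∑ b : (ZMod (2 ^ (m + 2)))ˣ, τ (m + 2) (b : ZMod (2 ^ (m + 2))) •
            ((∑' j : ℕ, algebraMap ℚ_[2] (PadicAlgCl 2) (PowerSeries.coeff j (W.map (algebraMap ℚ ℚ_[2])).formalLog) *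
                (WeierstrassCurve.Affine.Point.zCoord
                  (show (W.baseChange (AlgebraicClosure ℚ_[2])).toAffine.Point from Q₀)) ^ j) *
              e (m + 2) (u (m + 2) k))) ∧
    -- (VAL) the value law at the EVEN PRIMITIVE characters of conductor `2^N`, `N ≥ 2`, in every realisation `(R, s₁, s₂)`
    (∀ (N : ℕ), 2 ≤ N → ∀ (R : Type) [Field R] (s₁ : coeffField g →+* R) (s₂ : CyclotomicField (2 ^ N) ℚ →+* R)
      (χ : DirichletCharacter R (2 ^ N)), χ (-1) = 1 → χ.IsPrimitive →
      (∑ k : Fin (L N), s₁ (f N k) *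
          ∑ b : (ZMod (2 ^ N))ˣ, χ⁻¹ (b : ZMod (2 ^ N)) * s₂ (sigma (2 ^ N) b (u N k))) *
        gaussSum χ (AddChar.zmodChar (2 ^ N) ((hζc N).map_of_injective s₂.injective).pow_eq_one) =
      s₁ r * ∑ a : ZMod (2 ^ N), χ a * s₁ (plusSymbolK g Ω ((a.val : ℚ) / (2 : ℚ) ^ N))) ∧
    -- (TRIV) the value at the trivial character of every level `2^N`, `N ≥ 2`: the `2`-depleted central value
    (∀ (N : ℕ), 2 ≤ N → ∀ (R : Type) [Field R] (s₁ : coeffField g →+* R) (s₂ : CyclotomicField (2 ^ N) ℚ →+* R),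
      2 * ∑ k : Fin (L N), s₁ (f N k) * ∑ b : (ZMod (2 ^ N))ˣ, s₂ (sigma (2 ^ N) b (u N k)) =
        s₁ r * (2 - s₁ ⟨cuspCoeff g 2, coeff_mem_coeffField g 2⟩ + (if 2 ∣ M then 0 else 1)) *
          s₁ (plusSymbolK g Ω 0)) ∧
    -- (FIN) [k2-g31] Kato Thm. 12.5 (2) [p. 221] for the CM form via §15.16, read on the `ℤ₂`-tower by `Δ`-descent `⊗ ℚ` (F2):
    --       the zeta quotient `𝐇¹_Γ(T_ρ) ⧸ Λ_𝒪 z` is `Λ`-torsion, i.e. finite-dimensional after `Frac 𝒪 ⊗_𝒪 –`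
    Module.Finite (FractionRing ↥(padicCoeffIntegers (Set.range ι)))
      (TensorProduct ↥(padicCoeffIntegers (Set.range ι)) (FractionRing ↥(padicCoeffIntegers (Set.range ι)))
        (I.H ⧸ Submodule.span (IwasawaAlgebraO (Set.range ι)) ({z} : Set I.H))) ∧
    -- (FINX) [k2-g31] Kato Thm. 12.4 (1) [p. 221] (= BT26 Thm. 2.3 (1)) ∘ Poitou–Tate (F4): `X₀(A_ρ/ℚ_∞)` is `Λ`-torsion —
    --        finite-dimensional after `Frac 𝒪 ⊗_𝒪 –` (without it `Module.finrank = 0` on an infinite-dimensional space would make (LAM) over-claim)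
    Module.Finite (FractionRing ↥(padicCoeffIntegers (Set.range ι)))
      (TensorProduct ↥(padicCoeffIntegers (Set.range ι)) (FractionRing ↥(padicCoeffIntegers (Set.range ι)))
        (CharacterModule ↥X)) ∧
    -- (LAM) [k2-g31] Burungale–Tian Thm. 2.6 (`ξ(𝐇²(V)) = ξ(𝐇¹(V)/Z(g))` in `Λ ⊗ ℚ`, CM `g`, any `p`) ∘ `e₊`-component (F2/F3) ∘
    --       Poitou–Tate over `ℚ_∞` with finite local `H⁰`'s (F4): `λ_𝒪(𝐇¹_Γ ⧸ Λ_𝒪 z) ≤ λ_𝒪(X₀(A_ρ/ℚ_∞))` (print gives `=`; `≤` is what is consumed)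
    Module.finrank (FractionRing ↥(padicCoeffIntegers (Set.range ι)))
        (TensorProduct ↥(padicCoeffIntegers (Set.range ι)) (FractionRing ↥(padicCoeffIntegers (Set.range ι)))
          (I.H ⧸ Submodule.span (IwasawaAlgebraO (Set.range ι)) ({z} : Set I.H))) ≤
      Module.finrank (FractionRing ↥(padicCoeffIntegers (Set.range ι)))
        (TensorProduct ↥(padicCoeffIntegers (Set.range ι)) (FractionRing ↥(padicCoeffIntegers (Set.range ι)))
          (CharacterModule ↥X))

/-! ## Bridges to the consumer (onepair `stub_kzgChildB`'s vocabulary) -/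

open Summit.BirchSwinnertonDyer.BirchSwinnertonDyer.Theorems.OnePair

variable {S : Set (PadicAlgCl 2)} {ρ : FramedGaloisRep ℚ ↥(padicCoeffIntegers S) 2} {κ : ZpExtension ℚ 2}
  {γ : absoluteGaloisGroup ℚ}

/-- (B1) The (FIN)/(LAM) left-hand side is DEFINITIONALLY the consumer's `lamO S (zetaQuot I z)` (so the adapter
`merged ⟹ child B at the witness` needs no transport on the zeta-quotient side). [cite: Kato2004Asterisque, Thm. 12.5 (2) (p. 221)] -/
theorem lamO_zetaQuot_eq (I : IwasawaH1DataCoeff ρ.toGaloisRep 2 κ γ) [Module ↥(padicCoeffIntegers S) I.H]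
    [IsScalarTower ↥(padicCoeffIntegers S) (IwasawaAlgebraO S) I.H] (z : I.H) :
    lamO S (zetaQuot I z) =
      Module.finrank (FractionRing ↥(padicCoeffIntegers S))
        (TensorProduct ↥(padicCoeffIntegers S) (FractionRing ↥(padicCoeffIntegers S))
          (I.H ⧸ Submodule.span (IwasawaAlgebraO S) ({z} : Set I.H))) := rfl

/-- (B1′) … and (FIN) is, as a `Prop`, SYNTACTICALLY child B's (ii_fin) clause `Module.Finite (Frac 𝒪) (Frac 𝒪 ⊗ zetaQuot I z)`
(`zetaQuot` is a reducible abbreviation). [cite: Kato2004Asterisque, Thm. 12.5 (2) (p. 221)] -/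
theorem fin_clause_eq (I : IwasawaH1DataCoeff ρ.toGaloisRep 2 κ γ) [Module ↥(padicCoeffIntegers S) I.H]
    [IsScalarTower ↥(padicCoeffIntegers S) (IwasawaAlgebraO S) I.H] (z : I.H) :
    Module.Finite (FractionRing ↥(padicCoeffIntegers S))
        (TensorProduct ↥(padicCoeffIntegers S) (FractionRing ↥(padicCoeffIntegers S)) (zetaQuot I z)) =
      Module.Finite (FractionRing ↥(padicCoeffIntegers S))
        (TensorProduct ↥(padicCoeffIntegers S) (FractionRing ↥(padicCoeffIntegers S))
          (I.H ⧸ Submodule.span (IwasawaAlgebraO S) ({z} : Set I.H))) := rfl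

/-- (B2) `λ_𝒪` of a trivial module is `0` (every tensor is `0`). [cite: Kato2004Asterisque, §13.8 (p. 228)] -/
theorem lamO_eq_zero_of_subsingleton (X : Type*) [AddCommGroup X] [Module ↥(padicCoeffIntegers S) X]
    [Subsingleton X] : lamO S X = 0 := by
  haveI : Subsingleton (TensorProduct ↥(padicCoeffIntegers S) (FractionRing ↥(padicCoeffIntegers S)) X) := by
    refine ⟨fun x y => ?_⟩
    have hx : ∀ t : TensorProduct ↥(padicCoeffIntegers S) (FractionRing ↥(padicCoeffIntegers S)) X, t = 0 := by
      intro t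
      induction t using TensorProduct.induction_on with
      | zero => rfl
      | tmul a b => rw [Subsingleton.elim b 0, TensorProduct.tmul_zero]
      | add a b ha hb => rw [ha, hb, add_zero]
    rw [hx x, hx y]
  exact Module.finrank_zero_of_subsingleton

/-- (B3) Child B's `Λ`-multiplier slack VANISHES at `μt := 1` (the port of p726418 takes `μt := 1`, pen P1–P5 SCALARS):
`λ_𝒪(Λ_𝒪 ⧸ (1)) = 0`. [cite: Kato2004Asterisque, §13.8 (p. 228)] -/
theorem lamO_quot_span_one_eq_zero :
    lamO S (IwasawaAlgebraO S ⧸ Ideal.span ({(1 : IwasawaAlgebraO S)} : Set (IwasawaAlgebraO S))) = 0 := by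
  haveI : Subsingleton (IwasawaAlgebraO S ⧸ Ideal.span ({(1 : IwasawaAlgebraO S)} : Set (IwasawaAlgebraO S))) :=
    Ideal.Quotient.subsingleton_iff.mpr (Ideal.span_singleton_one)
  exact lamO_eq_zero_of_subsingleton _

/-- (B4) THE ADAPTER'S ARITHMETIC: from the merged fact's (LAM) `λ(𝐇¹/Λz) ≤ λ(X₀)` to child B's registered right-hand
side `λ(Sel₀^∨) + λ(Λ/(μt))` at `μt := 1`. [cite: BurungaleTian2026, Thm. 2.6 (p. 5)] -/
theorem childB_rhs_of_le {a b : ℕ} (h : a ≤ b) :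
    a ≤ b + lamO S (IwasawaAlgebraO S ⧸ Ideal.span ({(1 : IwasawaAlgebraO S)} : Set (IwasawaAlgebraO S))) := by
  rw [lamO_quot_span_one_eq_zero, add_zero]; exact h

end Summit.BirchSwinnertonDyer.BirchSwinnertonDyer.Cruxes.ResidualThetaCountLowerPureAtTwo.SideaK2G31

end
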